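import Summits.QuantumFields.BalabanUV.T4Continuum.Support.MinimalActionRate
import Summits.QuantumFields.BalabanUV.T4Continuum.Support.SmoothRefineSlices
import HarnessLib

/-!
# NE7InteriorInduction — [Balaban1985Variational] SECT. A IN THE DICTIONARY: the existence of interior constrained minimisers
# AT EVERY LEVEL ((8)∃ of `NE7InteriorMinimiserDocking`) follows by INDUCTION ON THE LEVEL from a ONE-STEP statement, the
# competitor of level `k+1` being the SLICE PULLBACK of the interior minimiser of level `k`

Cell `pub-balaban`, rung (B)+1 sub-cell t4, lineage `b2b-balaban-t4-ne7-p1`, generation 64 (CRUX PROVER NE7 #1, ruling e34b3e0c (2)); hunt (h8)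
«REGULARITY ROAD», step (h8-i).  After gen 64's file 1 the energy road's (H∃)ᴱ rests on ONE hypothesis, (8)∃: «for every datum `V ∈ dom` and every
level `k` SOME `k`-level constrained minimiser over `sfClass d L N ε` is `SmallField U a` with `a < ε(L^k)^{−2}`» — the shape of the existence
clause (8) of [Balaban1985Variational] Thm 1 p. 279 (a minimal orbit of the big space `𝔘_k(ε₀)` lying in the small space `𝔘_k(B₃ε₁)`).  The
print proves Thm 1 «by induction with respect to k» (p. 279), the level-`k` problem receiving as BACKGROUND the refined minimiser of level
`k−1` (Sect. A (11)–(14), pp. 279–280: «U₀ ∈ 𝔘_k({Ω_j}, C₁B₃ε₁) … The configuration U₀ constructed above satisfies (14) with C₁ = L³»), and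
then works from (14) alone («we will consider a little bit more general configuration U₀ … satisfying (14)»).  This file is that induction in
the cell's dictionary (closed classes `sfClass`, everywhere-small-field case, one torus):
§1 THE SLICE PULLBACK `SmoothRefineBlocks.slicePull L U` (fine bond `= U ⌊y∕L⌋ μ` on the last `μ`-slice of its block, `1` elsewhere; NE3
swarm row S4b, group-general) as a NON-ABELIAN competitor: unitary (`isUnitaryCfg_slicePull`), `L·P`-periodic (`isPeriodicCfg_slicePull`),
SAME plaquette radius (`smallField_slicePull`: its fine plaquettes are corner pullbacks of the coarse ones or `1`, `hol_slicePull_plaqWord`), and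
its one-step average (42) IS `U` (`rescale_bavg_slicePull`: the loop variables of (42) are trivial, `Wcx_slicePull`, the straight contour reads
`U`, `hol_slicePull_seg`), hence `avgIter L (slicePull L U) (k+1) = avgIter L U k` (`avgIter_slicePull_succ`);
§2 ADMISSIBILITY: the pullback of a level-`k` admissible configuration of plaquette radius `a ≤ ε(L^{k+1})^{−2}` is admissible at level `k+1`
for the same datum (`slicePull_mem_admissible`) — (11)–(13) of Sect. A with `C₁ = L²` in the closed-class dictionary;
§3 **`interior_exists_all_levels`** — THE INDUCTION: if the datum `V` is unitary, `N`-periodic, `SmallField V δ_V`, `δ_V ≤ δ`, `δ·L² ≤ ε`, and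
ONE-STEP holds («at every level `k+1`, given an ADMISSIBLE competitor `U₀` with `SmallField U₀ (δ(L^k)^{−2})`, SOME `(k+1)`-level constrained
minimiser is `SmallField · (δ(L^{k+1})^{−2})`» — [Balaban1985Variational] Thm 1 given (14), TYPE; a HYPOTHESIS asserted for nothing), then at
EVERY level some constrained minimiser is `SmallField · (δ(L^k)^{−2})`; **`hint_of_oneStep`** — hence (8)∃ verbatim (the `hint` binder of
`NE7InteriorMinimiserDocking.hminE_of_interior_exists`) over `dom = {unitary, N-periodic, SmallField · δ_V}` as soon as `δ < ε`.
So the energy road's residual is now the ONE-STEP interior regularity of the constrained Wilson minimiser GIVEN A GOOD COMPETITOR — Sections B–F of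
[Balaban1985Variational] (Landau gauge, expansion around `U₀`, positivity and decay of the constrained Hessian's Green's function
[Balaban1984PropagatorsI/II], contraction) — NOT in the tree, NOT proved here.
HONEST FRAMING (page 1): lattice kinematics + an induction over HYPOTHESES on a FIXED FINITE torus, rung (B)+1; NE7, NE3 NOT PRINTED in
[Balaban1984PropagatorsI]–[Balaban1989LargeFieldII] and NOT PROVED; continuum YM on T⁴ ⇐ BetaPertH ∧ nine spine estimates (0/9 proved);
BetaPertH ⇐ (D1) ∧ (D4) ∧ CAP+tail; G-an2-4 gates asym, D1 and NE2/3/4; NOT infinite volume, NOT mass gap, NOT Clay.  0 def, 0 sorry.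
-/

set_option autoImplicit false

open scoped BigOperators Matrix Matrix.Norms.L2Operator
open NormedSpace Finset

namespace Summit.QuantumFields.BalabanUV.T4Continuum.NE7InteriorInduction

open Literature.MathematicalPhysics.QuantumFieldTheory.Balaban1983to89
open B7Prop1Explicit B7Prop2Explicit MatrixLog UnitaryModel
open T4AveragingDeficitWall (IsUnitaryCfg SmallField)
open T4AveragingDeficitWallBoundary (IsPeriodicCfg)
open MinimalActionSandwich (IsMinimiser admissible)
open MinimalActionRate (sfClass)
open SmoothRefineBlocks SmoothRefineSlices

noncomputable section

variable {d : ℕ} {n : Type*} [Fintype n] [DecidableEq n]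

/-! ## §1 The slice pullback as a non-abelian competitor -/

/-- The slice pullback of a `U(N)`-valued configuration is `U(N)`-valued (its values are values of `U` or `1`). [folklore] -/
theorem isUnitaryCfg_slicePull (L : ℕ) {U : Site d → Fin d → (Matrix n n ℂ)ˣ} (hU : IsUnitaryCfg U) : IsUnitaryCfg (slicePull L U) := by
  intro y μ
  unfold slicePull
  split_ifs
  · exact hU _ _
  · exact (unitaryUnits (Matrix n n ℂ)).one_mem

/-- The slice pullback of a `P`-periodic configuration is `L·P`-periodic (`SmoothRefineBlocks.slicePull_add_period`). [folklore] -/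
theorem isPeriodicCfg_slicePull {L : ℕ} (hL : 1 ≤ L) {U : Site d → Fin d → (Matrix n n ℂ)ˣ} {P : ℤ} (hU : IsPeriodicCfg U P) :
    IsPeriodicCfg (slicePull L U) ((L : ℤ) * P) :=
  fun y κ μ => slicePull_add_period hL U hU y κ μ

/-- **SAME PLAQUETTE RADIUS**: `SmallField U a`, `0 ≤ a` ⟹ `SmallField (slicePull L U) a` — the fine plaquettes of the pullback are the coarse
plaquettes of `U` at the block corners and `1` elsewhere (`hol_slicePull_plaqWord`); Sect. A's «from the form (2) of the regularity conditions it
follows that U₀ ∈ 𝔘_k» in the dictionary. [folklore] -/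
theorem smallField_slicePull {L : ℕ} (hL : 1 ≤ L) {U : Site d → Fin d → (Matrix n n ℂ)ˣ} {a : ℝ} (ha : 0 ≤ a) (hU : SmallField U a) :
    SmallField (slicePull L U) a := by
  intro y κ κ' hκ
  rw [hol_slicePull_plaqWord hL U y hκ]
  split_ifs
  · exact hU _ _ _ hκ
  · simpa using ha

/-- **THE ONE-STEP AVERAGE (42) OF THE SLICE PULLBACK IS THE COARSE CONFIGURATION**: `rescale L (bavg L (slicePull L U)) = U` — the loop
variables `W_{c,x}` of (42) are trivial on a pullback (`Wcx_slicePull`), so the exponent `X_c` vanishes, and the straight contour reads `U`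
(`hol_slicePull_seg`); Sect. A (11) «V̄₀ = V on Λ_k» in the dictionary. [folklore] -/
theorem rescale_bavg_slicePull {L : ℕ} (hL : 1 ≤ L) (U : Site d → Fin d → (Matrix n n ℂ)ˣ) : rescale L (bavg L (slicePull L U)) = U := by
  funext z κ
  have hX : Xavg L (slicePull L U) ((L : ℤ) • z) κ = 0 := by
    unfold Xavg
    simp only [Wcx_slicePull hL, Units.val_one, mlog_one, smul_zero, Finset.sum_const_zero]
  have hE : expUnit (Xavg L (slicePull L U) ((L : ℤ) • z) κ) = 1 := Units.ext (by rw [val_expUnit, hX, exp_zero]; rfl)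
  show expUnit (Xavg L (slicePull L U) ((L : ℤ) • z) κ) * hol (slicePull L U) ((L : ℤ) • z) (seg κ L) = U z κ
  rw [hE, one_mul, hol_slicePull_seg hL, (blk_res_smul hL z).1]

/-- Hence the `(k+1)`-fold average (43) of the pullback is the `k`-fold average of `U`. [folklore] -/
theorem avgIter_slicePull_succ {L : ℕ} (hL : 1 ≤ L) (U : Site d → Fin d → (Matrix n n ℂ)ˣ) (k : ℕ) :
    avgIter L (slicePull L U) (k + 1) = avgIter L U k := by
  rw [← MinimalActionLevels.avgIter_rescale_bavg, rescale_bavg_slicePull hL]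

/-! ## §2 Admissibility of the pullback one level up -/

/-- **THE PULLBACK IS IN THE NEXT CLASS**: a unitary `(N·L^k)`-periodic configuration with `SmallField U a`, `0 ≤ a ≤ ε(L^{k+1})^{−2}`, pulls back
into `sfClass d L N ε (k+1)` (period `N·L^{k+1} = L·(N·L^k)`). [folklore] -/
theorem slicePull_mem_sfClass {L N k : ℕ} (hL : 1 ≤ L) {ε a : ℝ} {U : Site d → Fin d → (Matrix n n ℂ)ˣ} (hUu : IsUnitaryCfg U)
    (hUp : IsPeriodicCfg U ((N * L ^ k : ℕ) : ℤ)) (ha : 0 ≤ a) (hUa : SmallField U a) (haε : a ≤ ε / ((L : ℝ) ^ (k + 1)) ^ 2) :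
    slicePull L U ∈ sfClass d L N ε (k + 1) := by
  refine ⟨isUnitaryCfg_slicePull L hUu, ?_, MinimalActionRate.SmallField.mono (smallField_slicePull hL ha hUa) haε⟩
  have e : ((N * L ^ (k + 1) : ℕ) : ℤ) = (L : ℤ) * ((N * L ^ k : ℕ) : ℤ) := by push_cast; ring
  rw [e]
  exact isPeriodicCfg_slicePull hL hUp

/-- **SECT. A (11)–(13) IN THE DICTIONARY**: the pullback of a level-`k` ADMISSIBLE configuration (datum `V`) of plaquette radius
`a ≤ ε(L^{k+1})^{−2}` is ADMISSIBLE at level `k+1` for the same datum. [folklore] -/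
theorem slicePull_mem_admissible {L N k : ℕ} (hL : 1 ≤ L) {ε a : ℝ} {V U : Site d → Fin d → (Matrix n n ℂ)ˣ}
    (hU : U ∈ admissible (sfClass d L N ε) L k V) (ha : 0 ≤ a) (hUa : SmallField U a) (haε : a ≤ ε / ((L : ℝ) ^ (k + 1)) ^ 2) :
    slicePull L U ∈ admissible (sfClass d L N ε) L (k + 1) V :=
  ⟨slicePull_mem_sfClass hL hU.1.1 hU.1.2.1 ha hUa haε, by rw [avgIter_slicePull_succ hL]; exact hU.2⟩

/-! ## §3 The induction on the level -/

/-- **THE INDUCTION OF [Balaban1985Variational] SECT. A, IN THE DICTIONARY.**  Let `L ≥ 1`, `0 ≤ δ_V ≤ δ`, `δ·L² ≤ ε`, and let the datum `V` be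
unitary, `N`-periodic with `SmallField V δ_V`.  Assume ONE-STEP: for every level `k` and every ADMISSIBLE competitor `U₀` of level `k+1` (class
`sfClass d L N ε`, datum `V`) with `SmallField U₀ (δ(L^k)^{−2})`, SOME `(k+1)`-level constrained minimiser is `SmallField · (δ(L^{k+1})^{−2})`
([Balaban1985Variational] Thm 1 given a background (14), TYPE — a HYPOTHESIS).  THEN at every level `k` some constrained minimiser is
`SmallField · (δ(L^k)^{−2})`: the competitor of level `k+1` is the slice pullback of the level-`k` minimiser (§2, radius `δ(L^k)^{−2} ≤ ε(L^{k+1})^{−2}`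
by `δL² ≤ ε`); level `0` is the datum itself (`δ_V ≤ δ ≤ ε`; cf. `MinimalActionDictionary.isMinimiser_zero` at `n : Type`). [folklore] -/
theorem interior_exists_all_levels {L N : ℕ} (hL : 1 ≤ L) {ε δ δV : ℝ} (hδV : 0 ≤ δV) (hδVδ : δV ≤ δ) (hδL : δ * (L : ℝ) ^ 2 ≤ ε)
    {V : Site d → Fin d → (Matrix n n ℂ)ˣ} (hVu : IsUnitaryCfg V) (hVp : IsPeriodicCfg V (N : ℤ)) (hVδ : SmallField V δV)
    (hstep : ∀ (k : ℕ) (U₀ : Site d → Fin d → (Matrix n n ℂ)ˣ), U₀ ∈ admissible (sfClass d L N ε) L (k + 1) V →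
      SmallField U₀ (δ / ((L : ℝ) ^ k) ^ 2) →
      ∃ U, IsMinimiser d (sfClass d L N ε) L N (k + 1) V U ∧ SmallField U (δ / ((L : ℝ) ^ (k + 1)) ^ 2)) :
    ∀ k : ℕ, ∃ U, IsMinimiser d (sfClass d L N ε) L N k V U ∧ SmallField U (δ / ((L : ℝ) ^ k) ^ 2) := by
  have hL1 : (1 : ℝ) ≤ L := by exact_mod_cast hL
  have hL0 : (0 : ℝ) < L := by linarith
  have hδ : 0 ≤ δ := hδV.trans hδVδ
  have hδε : δ ≤ ε := by nlinarith [one_le_pow₀ (n := 2) hL1]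
  intro k
  induction k with
  | zero =>
      have hV0 : SmallField V (δ / ((L : ℝ) ^ 0) ^ 2) := by
        simpa using MinimalActionRate.SmallField.mono hVδ hδVδ
      have hVmem : V ∈ sfClass d L N ε 0 :=
        ⟨hVu, by simpa using hVp, by simpa using MinimalActionRate.SmallField.mono hVδ (hδVδ.trans hδε)⟩
      -- the datum is the unique admissible configuration of run `0` (the `0`-fold average (43) is the identity)
      exact ⟨V, ⟨⟨hVmem, rfl⟩, fun U' hU' => by rw [show U' = V from hU'.2]⟩, hV0⟩
  | succ k ih =>
      obtain ⟨U, hmin, hUa⟩ := ih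
      have ha : 0 ≤ δ / ((L : ℝ) ^ k) ^ 2 := by positivity
      have haε : δ / ((L : ℝ) ^ k) ^ 2 ≤ ε / ((L : ℝ) ^ (k + 1)) ^ 2 := by
        rw [div_le_div_iff₀ (by positivity) (by positivity)]
        have e : ((L : ℝ) ^ (k + 1)) ^ 2 = ((L : ℝ) ^ k) ^ 2 * (L : ℝ) ^ 2 := by ring
        rw [e]
        have h0 : 0 ≤ ((L : ℝ) ^ k) ^ 2 := by positivity
        nlinarith
      exact hstep k (slicePull L U) (slicePull_mem_admissible hL hmin.mem ha hUa haε) (smallField_slicePull hL ha hUa)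

/-- **(8)∃ FROM ONE-STEP** — the `hint` binder of `NE7InteriorMinimiserDocking.hminE_of_interior_exists` VERBATIM over the small data
`dom = {V | IsUnitaryCfg V ∧ IsPeriodicCfg V N ∧ SmallField V δ_V}` (`0 ≤ δ_V ≤ δ < ε`, `δ·L² ≤ ε`, `L ≥ 1`): if ONE-STEP holds for every datum of
`dom`, then for every `V ∈ dom` and every level `k` some `k`-level constrained minimiser over `sfClass d L N ε` is `SmallField U a` with
`0 ≤ a < ε(L^k)^{−2}` (`a = δ(L^k)^{−2}`).  ONE-STEP ([Balaban1985Variational] Thm 1 given (14), TYPE) is a HYPOTHESIS asserted for nothing;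
NOT NE7. [folklore] -/
theorem hint_of_oneStep {L N : ℕ} (hL : 1 ≤ L) {ε δ δV : ℝ} (hδV : 0 ≤ δV) (hδVδ : δV ≤ δ) (hδε : δ < ε) (hδL : δ * (L : ℝ) ^ 2 ≤ ε)
    (hstep : ∀ V : Site d → Fin d → (Matrix n n ℂ)ˣ, IsUnitaryCfg V → IsPeriodicCfg V (N : ℤ) → SmallField V δV →
      ∀ (k : ℕ) (U₀ : Site d → Fin d → (Matrix n n ℂ)ˣ), U₀ ∈ admissible (sfClass d L N ε) L (k + 1) V →
        SmallField U₀ (δ / ((L : ℝ) ^ k) ^ 2) →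
        ∃ U, IsMinimiser d (sfClass d L N ε) L N (k + 1) V U ∧ SmallField U (δ / ((L : ℝ) ^ (k + 1)) ^ 2)) :
    ∀ V ∈ {V : Site d → Fin d → (Matrix n n ℂ)ˣ | IsUnitaryCfg V ∧ IsPeriodicCfg V (N : ℤ) ∧ SmallField V δV}, ∀ k : ℕ,
      ∃ U : Site d → Fin d → (Matrix n n ℂ)ˣ, IsMinimiser d (sfClass d L N ε) L N k V U ∧
        ∃ a : ℝ, 0 ≤ a ∧ a < ε / ((L : ℝ) ^ k) ^ 2 ∧ SmallField U a := by
  rintro V ⟨hVu, hVp, hVδ⟩ k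
  have hL0 : (0 : ℝ) < L := by exact_mod_cast (show 0 < L by omega)
  obtain ⟨U, hmin, hUa⟩ := interior_exists_all_levels hL hδV hδVδ hδL hVu hVp hVδ (hstep V hVu hVp hVδ) k
  have hδ : 0 ≤ δ := hδV.trans hδVδ
  exact ⟨U, hmin, δ / ((L : ℝ) ^ k) ^ 2, by positivity, div_lt_div_of_pos_right hδε (by positivity), hUa⟩

end

end Summit.QuantumFields.BalabanUV.T4Continuum.NE7InteriorInduction
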